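import Summits.CriticalPhenomena.PercolationContinuityZ3.Theorems.PercLowPointHalfSpaceBoundaryTwoArmDecayKTailReduction

/-!
# Crux `PercLowPointHalfSpace.BoundaryTwoArmDecay` (stmt-CriticalPhenomena-0911), line
# `staircase-bootstrap-floor-decoupling` (lead c1): the PARAMETRIC reduction — polynomial multiplicity loss `c` against slab exponent `A`

`…KTailReduction.lean` (p140944) reduced crux A to {KTail, SlabCrossover A for some A < 6/5, SubpolynomialBlocking}, where KTail asks
for a SUBPOLYNOMIAL loss: `∀ s > 0`, eventually `n^{-s} P(A_n) ≤ P(A_n ∧ K_n ≤ ⌈n^s⌉)`.  This file records the weakest multiplicity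
input the line can digest, as a registered sub-goal of the crux item (`stub_kTailAtReduction`, `--supports stmt-CriticalPhenomena-0911`):
a FIXED polynomial loss `c > 0` suffices as soon as `5A + 4c < 6`,

  `KTailAt c → SlabCrossover A → SubpolynomialBlocking → BoundaryTwoArmDecay`   (`0 < c`, `1 ≤ A`, `5A + 4c < 6`),

`KTailAt c`: eventually `n^{-c} P(A_n) ≤ P(A_n ∧ K_n ≤ ⌈n^c⌉)` (one exponent, no quantifier over `s`).  With the physical slab exponent
`A = 1` any `c < 1/4` will do; KTail is `∀ c > 0, KTailAt c`.  At the other end of the menu, the registered sub-goal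
`stub_kTailOfTight` records that TIGHTNESS of the conditional law of `K_n` on `A_n` (uniformly in `n`; MC: conditional means
`4.82 / 4.32 / 4.03` at `n = 8 / 16 / 32`) implies KTail.

Notation: `A_n = StubStep.kissV n 0 1` (both `ℍ`-clusters of the adjacent floor roots `0, e` meet level `n` and are distinct),
`K_n = (StubStep.partnerKiss n ω).ncard` (partner-kiss floor edges of `U = C_ℍ(0)`), `e_n = StubStep.exactDens n`, `ν_n = StubStep.tallDens n`.

## Proof

`StubDirectStep.pointwise` (p140944) at loss `c`: `P(A_n) ≤ 2 C₁⁺ n^{2c} e_n` for `n ≥ N₀`; dyadic averaging with the tall density at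
`t` (`StubStep.even_bound`, `StubStep.sum_exactDens_toReal_le`, `StubStep.decay_of_eventually`): vertical exponent `a = 3 - 2c - t`
(`aprioriV_of_kTailAt`).  With `δ := 6 - 5A - 4c > 0`, `t = δ/8` and `b = 5/2 + δ/4`: `b·A < a ⟺ A < 3/2`, true since `5A < 6`; the
landed reach reduction `stub_reach` (p130902) gives `P(E_r) ≤ C r^{-b}`, i.e. the crux with `κ = δ/4`.
-/

noncomputable section

namespace Summit.CriticalPhenomena.PercolationContinuityZ3.Theorems.BoundaryTwoArmDecay

open MeasureTheory
open scoped ENNReal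
open Literature.Probability.Percolation Literature.Probability.LatticeModels

namespace StubDirectStep

open Negative (μ)
open StubStep (kissV partnerKiss exactDens tallDens kissV_antitone_level sum_exactDens_toReal_le even_bound
  decay_of_eventually)

/-- **The direct step at a FIXED loss.** From the census, the tall-density bound and `KTailAt c` (eventually
`n^{-c} P(A_n) ≤ P(A_n ∧ K_n ≤ ⌈n^c⌉)`, `c ≥ 0`): `AprioriV (3 - 2c - t)` for every `t > 0`. -/
theorem aprioriV_of_kTailAt
    (hCensus : ∃ C : ℝ, ∀ n k : ℕ, 1 ≤ n → 1 ≤ k →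
      μ.real (kissV n 0 1 ∩ {ω | (partnerKiss n ω).ncard ≤ k}) ≤ C * (k : ℝ) * (exactDens n).toReal)
    (hTall : ∀ s : ℝ, 0 < s → ∃ C : ℝ, ∀ n : ℕ, 1 ≤ n → tallDens n ≤ ENNReal.ofReal (C * (n : ℝ) ^ (s - 2)))
    {c : ℝ} (hc : 0 ≤ c)
    (hK : ∀ᶠ n : ℕ in Filter.atTop,
      (n : ℝ) ^ (-c) * μ.real (kissV n 0 1) ≤
        μ.real (kissV n 0 1 ∩ {ω | (partnerKiss n ω).ncard ≤ ⌈(n : ℝ) ^ c⌉₊}))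
    {t : ℝ} (ht : 0 < t) :
    ∃ C : ℝ, ∀ n : ℕ, 1 ≤ n → μ.real (kissV n 0 1) ≤ C * (n : ℝ) ^ (-(3 - (c + c) - t)) := by
  obtain ⟨C₁, hC₁⟩ := hCensus
  obtain ⟨Ct, hCt⟩ := hTall t ht
  obtain ⟨N₀, hN₀⟩ := Filter.eventually_atTop.1 hK
  have hγ0 : 0 ≤ c + c := add_nonneg hc hc
  have hC₂0 : (0 : ℝ) ≤ 2 * max C₁ 0 := mul_nonneg zero_le_two (le_max_right _ _)
  -- the bound at every `n ≥ max N₀ 1`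
  have hstep : ∀ n : ℕ, max N₀ 1 ≤ n →
      μ.real (kissV n 0 1) ≤ 2 * max C₁ 0 * (n : ℝ) ^ (c + c) * (exactDens n).toReal :=
    fun n hn => pointwise (le_of_max_le_right hn) hc (fun k hk => hC₁ n k (le_of_max_le_right hn) hk)
      (hN₀ n (le_of_max_le_left hn))
  -- dyadic averaging
  have hanti : ∀ m m' : ℕ, m ≤ m' → μ.real (kissV m' 0 1) ≤ μ.real (kissV m 0 1) :=
    fun m m' h => measureReal_mono (kissV_antitone_level h 0 1)
  have hsum : ∀ N : ℕ, 1 ≤ N →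
      ∑ m ∈ Finset.Icc N (2 * N), (exactDens m).toReal ≤ max Ct 0 * (N : ℝ) ^ (t - 2) :=
    fun N hN => sum_exactDens_toReal_le (hCt N hN)
  have heven : ∀ N : ℕ, max N₀ 1 ≤ N →
      μ.real (kissV (2 * N) 0 1) ≤ 2 * max C₁ 0 * (2 : ℝ) ^ (c + c) * max Ct 0 * (N : ℝ) ^ (-(3 - (c + c) - t)) := by
    intro N hN
    have hN1 : 1 ≤ N := le_of_max_le_right hN
    have h := even_bound (f := fun m => μ.real (kissV m 0 1)) (e := fun m => (exactDens m).toReal)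
      hγ0 hC₂0 (le_max_right Ct 0) (fun _ => ENNReal.toReal_nonneg) hanti hstep (hsum N hN1) hN hN1
    have hexp : c + c + t - 3 = -(3 - (c + c) - t) := by ring
    rw [hexp] at h
    exact h
  exact decay_of_eventually (f := fun m => μ.real (kissV m 0 1)) (le_max_right N₀ 1)
    (fun _ => measureReal_le_one) hanti heven

/-- **Tightness implies KTail.** If the conditional law of `K_n` on `A_n` is tight uniformly in `n` — for every `ε > 0` some
`M` has `P(A_n) ≤ P(A_n ∧ K_n ≤ M) + ε P(A_n)` for all `n ≥ 1` — then KTail holds: for every `s > 0`, eventually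
`n^{-s} P(A_n) ≤ P(A_n ∧ K_n ≤ ⌈n^s⌉)` (take `ε = 1/2` and `n` with `n^s ≥ max M 2`). -/
theorem kTail_of_tight
    (hT : ∀ ε : ℝ, 0 < ε → ∃ M : ℕ, ∀ n : ℕ, 1 ≤ n →
      μ.real (kissV n 0 1) ≤ μ.real (kissV n 0 1 ∩ {ω | (partnerKiss n ω).ncard ≤ M}) + ε * μ.real (kissV n 0 1))
    {s : ℝ} (hs : 0 < s) :
    ∀ᶠ n : ℕ in Filter.atTop, (n : ℝ) ^ (-s) * μ.real (kissV n 0 1) ≤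
      μ.real (kissV n 0 1 ∩ {ω | (partnerKiss n ω).ncard ≤ ⌈(n : ℝ) ^ s⌉₊}) := by
  obtain ⟨M, hM⟩ := hT (1 / 2) one_half_pos
  have htend : Filter.Tendsto (fun n : ℕ => (n : ℝ) ^ s) Filter.atTop Filter.atTop :=
    (tendsto_rpow_atTop hs).comp tendsto_natCast_atTop_atTop
  filter_upwards [htend.eventually_ge_atTop (max (M : ℝ) 2)] with n hn
  have hMn : (M : ℝ) ≤ (n : ℝ) ^ s := le_of_max_le_left hn
  have h2n : (2 : ℝ) ≤ (n : ℝ) ^ s := le_of_max_le_right hn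
  -- `n ≥ 1` (otherwise `n^s = 0 < 2`)
  have hn1 : 1 ≤ n := by
    rcases Nat.eq_zero_or_pos n with h0 | hpos
    · exfalso
      rw [h0, Nat.cast_zero, Real.zero_rpow hs.ne'] at h2n
      linarith
    · exact hpos
  have hnpos : (0 : ℝ) < n := by exact_mod_cast hn1
  have hP0 : 0 ≤ μ.real (kissV n 0 1) := measureReal_nonneg
  -- monotonicity in the threshold: `M ≤ ⌈n^s⌉`
  have hMk : M ≤ ⌈(n : ℝ) ^ s⌉₊ := by
    have : (M : ℝ) ≤ ⌈(n : ℝ) ^ s⌉₊ := hMn.trans (Nat.le_ceil _)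
    exact_mod_cast this
  have hmono : μ.real (kissV n 0 1 ∩ {ω | (partnerKiss n ω).ncard ≤ M}) ≤
      μ.real (kissV n 0 1 ∩ {ω | (partnerKiss n ω).ncard ≤ ⌈(n : ℝ) ^ s⌉₊}) :=
    measureReal_mono fun ω hω => ⟨hω.1, le_trans (show (partnerKiss n ω).ncard ≤ M from hω.2) hMk⟩
  -- `n^{-s} ≤ 1/2`
  have hinv : (n : ℝ) ^ (-s) ≤ 1 / 2 := by
    rw [Real.rpow_neg hnpos.le]
    have hpos : (0 : ℝ) < (n : ℝ) ^ s := by linarith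
    rw [inv_le_comm₀ hpos (by norm_num : (0 : ℝ) < 1 / 2)]
    simpa using h2n
  have hhalf := hM n hn1
  calc (n : ℝ) ^ (-s) * μ.real (kissV n 0 1) ≤ 1 / 2 * μ.real (kissV n 0 1) :=
        mul_le_mul_of_nonneg_right hinv hP0
    _ ≤ μ.real (kissV n 0 1 ∩ {ω | (partnerKiss n ω).ncard ≤ M}) := by linarith
    _ ≤ _ := hmono

end StubDirectStep

open StubDirectStep StubStep Negative in
/-- **Parametric conditional reduction of crux A** (registered sub-goal `stub_kTailAtReduction` of stmt-CriticalPhenomena-0911, line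
`staircase-bootstrap-floor-decoupling`, lead c1): for `0 < c`, `1 ≤ A` with `5A + 4c < 6`, the multiplicity input at FIXED polynomial
loss `c` — eventually `n^{-c} P(A_n) ≤ P(A_n ∧ K_n ≤ ⌈n^c⌉)` —, a polynomial slab crossover with exponent `A` (the body of stmt-6700
`SlabCrossoverPolynomial` at this `A`) and the tagged sibling crux `SubpolynomialBlocking` (stmt-4446) imply `BoundaryTwoArmDecay`.
Proof: `aprioriV_of_kTailAt` (fed by the landed `stub_census`, `stub_tallDensity`) at `t = δ/8`, `δ = 6 - 5A - 4c`, then the landed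
`stub_reach` with `b = 5/2 + δ/4` (`b·A < 3 - 2c - δ/8 ⟺ A < 3/2`), `κ = δ/4`. -/
theorem stub_kTailAtReduction :
    ∀ c A : ℝ, 0 < c → 1 ≤ A → 5 * A + 4 * c < 6 →
    (∀ᶠ n : ℕ in Filter.atTop,
      (n : ℝ) ^ (-c) *
          (bondPercolation (zdGraph 3) (criticalProbI 3)).real
            {ω | (∃ y : Site 3, (n : ℤ) ≤ y 0 ∧ ω ∈ openConnIn (halfSpace 3) 0 y) ∧
              (∃ y : Site 3, (n : ℤ) ≤ y 0 ∧ ω ∈ openConnIn (halfSpace 3) ((0 : Site 3) + Pi.single 1 1) y) ∧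
              ω ∉ openConnIn (halfSpace 3) 0 ((0 : Site 3) + Pi.single 1 1)} ≤
        (bondPercolation (zdGraph 3) (criticalProbI 3)).real
          ({ω | (∃ y : Site 3, (n : ℤ) ≤ y 0 ∧ ω ∈ openConnIn (halfSpace 3) 0 y) ∧
              (∃ y : Site 3, (n : ℤ) ≤ y 0 ∧ ω ∈ openConnIn (halfSpace 3) ((0 : Site 3) + Pi.single 1 1) y) ∧
              ω ∉ openConnIn (halfSpace 3) 0 ((0 : Site 3) + Pi.single 1 1)} ∩
            {ω | {q : Site 3 × Site 3 | q.1 0 = 0 ∧ q.2 0 = 0 ∧ (zdGraph 3).Adj q.1 q.2 ∧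
                ω ∈ openConnIn (halfSpace 3) 0 q.1 ∧ ω ∉ openConnIn (halfSpace 3) 0 q.2 ∧
                ∃ y : Site 3, (n : ℤ) ≤ y 0 ∧ ω ∈ openConnIn (halfSpace 3) q.2 y}.ncard ≤ ⌈(n : ℝ) ^ c⌉₊})) →
    (∃ C : ℝ, 0 < C ∧ ∀ k n : ℕ, 1 ≤ k → ∀ x : Site 3,
      (bondPercolation (zdGraph 3) (criticalProbI 3)).real
          {ω | ∃ y : Site 3, (n : ℤ) ≤ max |y 1 - x 1| |y 2 - x 2| ∧
            ω ∈ openConnIn {z : Site 3 | |z 0| ≤ (k : ℤ)} x y} ≤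
        C * (k : ℝ) ^ C * Real.exp (-((n : ℝ) / (C * (k : ℝ) ^ A)))) →
    Summit.CriticalPhenomena.PercolationContinuityZ3.Theses.PercNonProliferation.SubpolynomialBlocking →
      Summit.CriticalPhenomena.PercolationContinuityZ3.Theses.PercLowPointHalfSpace.BoundaryTwoArmDecay := by
  intro c A hc hA1 hcA hK hSlab hB
  -- the margin δ = 6 - 5A - 4c > 0
  set δ : ℝ := 6 - 5 * A - 4 * c with hδdef
  have hδ : 0 < δ := by rw [hδdef]; linarith
  have hA32 : A < 3 / 2 := by linarith
  -- the direct step at fixed loss c and tall-density loss t = δ/8: vertical exponent 3 - 2c - δ/8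
  have hV : ∃ C : ℝ, ∀ n : ℕ, 1 ≤ n → μ.real (kissV n 0 1) ≤ C * (n : ℝ) ^ (-(3 - (c + c) - δ / 8)) :=
    aprioriV_of_kTailAt stub_census (stub_tallDensity hB) hc.le hK (by positivity : (0 : ℝ) < δ / 8)
  -- reach: sup exponent b = 5/2 + δ/4, admissible since bA < 3 - 2c - δ/8 ⟺ A < 3/2
  set b : ℝ := 5 / 2 + δ / 4 with hbdef
  have hb : 0 < b := by rw [hbdef]; linarith
  have hbA : b * A < 3 - (c + c) - δ / 8 := by
    rw [hbdef]
    have h5A : 5 / 2 * A = 3 - 2 * c - δ / 2 := by rw [hδdef]; ring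
    nlinarith [mul_pos hδ (sub_pos.2 hA32)]
  obtain ⟨C, hC⟩ := stub_reach A hA1 hSlab (3 - (c + c) - δ / 8) b hb hbA hV
  -- κ = δ/4
  rw [boundaryTwoArmDecay_iff]
  refine ⟨δ / 4, C, by positivity, fun r hr => ?_⟩
  have hexp : (-(5 / 2 + δ / 4) : ℝ) = -b := by rw [hbdef]
  rw [hexp]
  exact hC r hr

open StubDirectStep in
/-- **Tightness implies KTail** (registered sub-goal `stub_kTailOfTight` of stmt-CriticalPhenomena-0911; a checked entry of the
MENU of sufficient multiplicity inputs for the planners): if for every `ε > 0` some threshold `M` has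
`P(A_n) ≤ P(A_n ∧ K_n ≤ M) + ε P(A_n)` for all `n ≥ 1` (the conditional law of the partner-kiss count on the kiss event is tight,
uniformly in the level — MC of lead a5: conditional means `4.82 / 4.32 / 4.03` at `n = 8 / 16 / 32`), then KTail holds.
Proof: `StubDirectStep.kTail_of_tight`. -/
theorem stub_kTailOfTight :
    (∀ ε : ℝ, 0 < ε → ∃ M : ℕ, ∀ n : ℕ, 1 ≤ n →
      (bondPercolation (zdGraph 3) (criticalProbI 3)).real
          {ω | (∃ y : Site 3, (n : ℤ) ≤ y 0 ∧ ω ∈ openConnIn (halfSpace 3) 0 y) ∧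
            (∃ y : Site 3, (n : ℤ) ≤ y 0 ∧ ω ∈ openConnIn (halfSpace 3) ((0 : Site 3) + Pi.single 1 1) y) ∧
            ω ∉ openConnIn (halfSpace 3) 0 ((0 : Site 3) + Pi.single 1 1)} ≤
        (bondPercolation (zdGraph 3) (criticalProbI 3)).real
            ({ω | (∃ y : Site 3, (n : ℤ) ≤ y 0 ∧ ω ∈ openConnIn (halfSpace 3) 0 y) ∧
                (∃ y : Site 3, (n : ℤ) ≤ y 0 ∧ ω ∈ openConnIn (halfSpace 3) ((0 : Site 3) + Pi.single 1 1) y) ∧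
                ω ∉ openConnIn (halfSpace 3) 0 ((0 : Site 3) + Pi.single 1 1)} ∩
              {ω | {q : Site 3 × Site 3 | q.1 0 = 0 ∧ q.2 0 = 0 ∧ (zdGraph 3).Adj q.1 q.2 ∧
                  ω ∈ openConnIn (halfSpace 3) 0 q.1 ∧ ω ∉ openConnIn (halfSpace 3) 0 q.2 ∧
                  ∃ y : Site 3, (n : ℤ) ≤ y 0 ∧ ω ∈ openConnIn (halfSpace 3) q.2 y}.ncard ≤ M}) +
          ε * (bondPercolation (zdGraph 3) (criticalProbI 3)).real
            {ω | (∃ y : Site 3, (n : ℤ) ≤ y 0 ∧ ω ∈ openConnIn (halfSpace 3) 0 y) ∧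
              (∃ y : Site 3, (n : ℤ) ≤ y 0 ∧ ω ∈ openConnIn (halfSpace 3) ((0 : Site 3) + Pi.single 1 1) y) ∧
              ω ∉ openConnIn (halfSpace 3) 0 ((0 : Site 3) + Pi.single 1 1)}) →
    ∀ s : ℝ, 0 < s → ∀ᶠ n : ℕ in Filter.atTop,
      (n : ℝ) ^ (-s) *
          (bondPercolation (zdGraph 3) (criticalProbI 3)).real
            {ω | (∃ y : Site 3, (n : ℤ) ≤ y 0 ∧ ω ∈ openConnIn (halfSpace 3) 0 y) ∧
              (∃ y : Site 3, (n : ℤ) ≤ y 0 ∧ ω ∈ openConnIn (halfSpace 3) ((0 : Site 3) + Pi.single 1 1) y) ∧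
              ω ∉ openConnIn (halfSpace 3) 0 ((0 : Site 3) + Pi.single 1 1)} ≤
        (bondPercolation (zdGraph 3) (criticalProbI 3)).real
          ({ω | (∃ y : Site 3, (n : ℤ) ≤ y 0 ∧ ω ∈ openConnIn (halfSpace 3) 0 y) ∧
              (∃ y : Site 3, (n : ℤ) ≤ y 0 ∧ ω ∈ openConnIn (halfSpace 3) ((0 : Site 3) + Pi.single 1 1) y) ∧
              ω ∉ openConnIn (halfSpace 3) 0 ((0 : Site 3) + Pi.single 1 1)} ∩
            {ω | {q : Site 3 × Site 3 | q.1 0 = 0 ∧ q.2 0 = 0 ∧ (zdGraph 3).Adj q.1 q.2 ∧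
                ω ∈ openConnIn (halfSpace 3) 0 q.1 ∧ ω ∉ openConnIn (halfSpace 3) 0 q.2 ∧
                ∃ y : Site 3, (n : ℤ) ≤ y 0 ∧ ω ∈ openConnIn (halfSpace 3) q.2 y}.ncard ≤ ⌈(n : ℝ) ^ s⌉₊}) :=
  fun hT _s hs => kTail_of_tight hT hs

end Summit.CriticalPhenomena.PercolationContinuityZ3.Theorems.BoundaryTwoArmDecay

end
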